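import Summits.QuantumFields.YangMills.Theorems.BalabanUVNodesN20HellingerRoadBoundedCurrent

/-!
# BalabanUVNodes ∕ node N20 (NE7b) — THE HELLINGER ROAD's ENDPOINT WITH NULL ∕ ONE-SIDED CLASSES, KERNEL: non-negative class weights suffice; a class of weight
# zero under one run has zero source current (Fermat), the response identity and the one-key kernel survive, the target and the strict TV budget follow with the
# only head «at every key and source SOME class is live under BOTH runs» (p607565's necessity)

Cell `pub-ymgap` (HUMAN RULING D-0062 Track A ∕ director-ym R399 (3a) width seats), WIDTH SEAT `pub-ymgap-dag-n20-w5` (node n20 = NE7b), generation g6,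
CLAIM-2 ∕ INTENT-2a (bus).  Key item K3⁸ `SpineGivenEndpointR13SepCoPHV` (stmt-QuantumFields-27366; skeleton of record v6 b4e55110ab73e679, stub `stub_expansion13HV`),
K3⁷ stmt-QuantumFields-20544 aside; filed `--kind proof --supports … --as helper`.  COUNT-NEUTRAL.  THEOREMS ONLY (0 `def`, 0 `instance`, 0 `notation`, 0 `sorry`).
ADDITIVE — imports this seat's p626582 `…N20HellingerRoadBoundedCurrent` (⊇ p623765 `…HellingerRoadCapstone`, p619159 `…HellingerEndpointRoad`, p618011, p616874,
dag-n20-w4's p609004, dag-n19-w2's p612301 `abs_classLawGap_le_sqrt_one_sub_affinity_sq`) — cited BY NAME; modifies nothing.  The ROAD (three ∃-capstones + A6 toy) is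
the sequel file `…N20HellingerRoadNullClasses` (INTENT-2b; split for the 400-line rule).

WHY.  The road of record (p619159 ∕ p623765 ∕ p626582) asks STRICT positivity `0 < A K t τ`, `0 < B K t τ` of BOTH runs' class weights on the WHOLE carrier `T K`.  At
the reading of record `crOfRecord₁₃V` (dag-n20-d p590105) the carrier is the union of the two runs' σ-key images and the class weights `weightA₁₃ ∕ weightB₁₃` are fibre
sums: off node U5d's flow agreement a key hit by ONE run only carries the OTHER run's weight `≡ 0` (dag-n20-w3 module 10, `weightA₁₃_eq_zero_of_not_mem_image` ∕
`weightB₁₃_…`) — so the strict letter cannot be keyed at the record without being structurally false at such tuples.  Nothing in the road needs it: the V-side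
(affinity, Le Cam) and dag-n20-w4's class-law road p609004 already take `0 ≤ A`; the R-side used `0 < A` only to cancel `A∕Z_A · A'∕A = A'∕Z_A` termwise — which survives a
null class as soon as its source current vanishes, and THAT is Fermat's rule for a non-negative differentiable function at a zero.  This file re-issues the KERNEL of the
endpoint road under `0 ≤ A`, `0 ≤ B` (all sources), keeping as the ONLY head «a two-sided live class at every `(K, t)` on the window» — the necessity proved by dag-n20-w4's
p607565 (under `HybridNE7` the two class laws are never mutually singular).
* §1 one key [folklore]: `deriv_eq_zero_of_nonneg_of_eq_zero` (Fermat, Mathlib `IsLocalMin.hasDerivAt_eq_zero`) · `response_split_of_nullRule` (p618011's identity under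
  «weight `0` ⇒ current `0`», Lean's `x ∕ 0 = 0` reading a null class's current as `0`) · ★ `abs_response_le_of_nonneg` (p618011's one-key kernel for `0 ≤ A, B`, positive
  totals) · `total_pos_of_twoSided` · ★ `abs_classLawGap_lt_one_of_twoSided` (one two-sided live class ⇒ every class-law gap `< 1`) ·
  `mixtureCurrentMoment_le_sq_of_boundedCurrent_of_nonneg` (p626582 §1 for `0 ≤ A, B`) · ★ `classLaw_nullSet_le_one_sub_affinity_sq` (the one-sided mass is PAID by
  (H): `p({q = 0}) ≤ 1 − 𝒜²`, Cauchy–Schwarz — null classes cost the road nothing).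
* §2 along `K` [folklore]: `nullRule_of_nonneg` · `totals_pos_of_twoSided` · `classLawTV_of_affinityDefect_of_nonneg` · `eta_nonneg_of_affinityDefect_of_nonneg` · ★★
  `target_of_endpointResponse_of_nonneg` ((H) + (R′) + (R‑c) ⇒ node U5's `Target`, non-negative weights) · ★★ `exists_classLawTV_budget_lt_one_of_nonneg` (EVT on the
  compact window; head = a two-sided live class per `(K, t)`).
READING (located, nothing proposed).  At the record the per-tuple letters left by this kernel are: source-differentiability of `weightA₁₃ ∕ weightB₁₃` on `|t| ≤ 1`, a
two-sided live key at every step and source, (H), (R′), (R‑c) (or a bounded current); non-negativity (n21's `weightA₁₃_nonneg`), positive totals and the E1∕E2 dictionary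
(dag-n20-d, under the keyed live line) are theorems — this seat's CLAIM-3 keys the sequel there.

HONEST FRAMING.  [folklore] Fermat + finite-sum real analysis + EVT on the tree's SHAPES; NO estimate of the programme is proved; every letter ((H), (R′), (R‑c), bounded
current, differentiability, the two-sided live class) is a HYPOTHESIS produced by nobody — (H)∕(R′) are the two-run content, UNPRINTED for d = 4; nothing of Bałaban's
asserted or instantiated (no `Provisos₁₃SepCoPH` tuple — K0⁷ OPEN); NE7 ∕ NE7b ∕ NE7c NOT PRINTED as two-run statements for d = 4 and NOT proved; N19′ ∕ N20 ∕ N21 NOT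
discharged; K3⁸ OPEN (v6 STANDS), K3⁷ aside, neither claimed; no summit statement is proved by this seat; counts UNMOVED (typed 28∕28 · discharged 5∕28; 5∕27 excl. NODE O).
One finite four-torus programme at fixed ε — NOT ℝ⁴, NOT infinite volume, NOT OS, NOT a mass gap, NOT the Clay problem (R4 closes the conditional finite-𝕋⁴ rung
`BalabanLadder.UV` only).  0 `def`; 0 `sorry`; standard axioms; no cite tags.
-/


noncomputable section

namespace Summit.QuantumFields.YangMills.BalabanUVNodes.N20HellingerRoadNullClassesKernel

open Finset Filter
open Summit.QuantumFields.BalabanUV.T4Continuum.Spine.NE7 (Target)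
open Literature.MathematicalPhysics.QuantumFieldTheory.Balaban1983to89
open T4MatchingAssembly (HybridNE7)
open Summit.QuantumFields.YangMills.BalabanUVNodes.N20HybridClassLawCharacterisation (exists_hybridNE7_of_target_of_classLawTV)
open Summit.QuantumFields.YangMills.BalabanUVNodes.N19AffinityClassIndexLaws
  (div_total_nonneg sum_div_total_eq_one affinity_le_one abs_classLawGap_le_sqrt_one_sub_affinity_sq)
open Summit.QuantumFields.YangMills.BalabanUVNodes.N20HellingerEndpointKernel (abs_mean_sub_mean_le_hellinger)
open Summit.QuantumFields.YangMills.BalabanUVNodes.N20HellingerEndpointClassWeights (hasDerivAt_log_total_sub_log_total matchingModConstants_of_derivative_bound)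
open Summit.QuantumFields.YangMills.BalabanUVNodes.N20HellingerEndpointRoad (sqrt_one_sub_sq_le)

variable {ι : Type*}

/-! ## §1 One key: Fermat's rule for null classes, the response identity under the null rule, the one-key kernel for non-negative weights [folklore] -/

section OneKey

/-- **FERMAT's RULE FOR A NULL CLASS** [folklore].  A function `f ≥ 0` everywhere, differentiable at `s` with derivative `f'`, and vanishing at `s`, has `f' = 0` — `s`
is a (global, hence local) minimum (Mathlib `IsLocalMin.hasDerivAt_eq_zero`).  For a class weight of record this says: a σ-key carrying no mass under one run at the
source value `s` carries no source CURRENT under that run at `s`. -/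
theorem deriv_eq_zero_of_nonneg_of_eq_zero {f : ℝ → ℝ} {f' s : ℝ} (h0 : ∀ u, 0 ≤ f u) (hs : f s = 0) (hd : HasDerivAt f f' s) : f' = 0 :=
  IsLocalMin.hasDerivAt_eq_zero (Filter.Eventually.of_forall fun u => by rw [hs]; exact h0 u) hd

variable {T : Finset ι}

/-- **THE ENDPOINT RESPONSE IDENTITY UNDER THE NULL RULE** [algebra; p618011 `response_split` without `A ≠ 0`].  If every class whose run-A (run-B) weight vanishes also
has vanishing run-A (run-B) derivative carrier, then with `p = A∕Z_A`, `q = B∕Z_B` (Lean's `x ∕ 0 = 0` reading the currents of null classes as `0`):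
`Z_B'∕Z_B − Z_A'∕Z_A = Σ_T q·(B'∕B − A'∕A) + (Σ_T q·(A'∕A) − Σ_T p·(A'∕A))`. -/
theorem response_split_of_nullRule {A B A' B' : ι → ℝ} (hA : ∀ τ ∈ T, A τ = 0 → A' τ = 0) (hB : ∀ τ ∈ T, B τ = 0 → B' τ = 0) :
    (∑ τ ∈ T, B' τ) / (∑ τ ∈ T, B τ) - (∑ τ ∈ T, A' τ) / (∑ τ ∈ T, A τ)
      = ∑ τ ∈ T, B τ / (∑ σ ∈ T, B σ) * (B' τ / B τ - A' τ / A τ)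
        + (∑ τ ∈ T, B τ / (∑ σ ∈ T, B σ) * (A' τ / A τ) - ∑ τ ∈ T, A τ / (∑ σ ∈ T, A σ) * (A' τ / A τ)) := by
  -- termwise cancellation `X∕Z · (X'∕X) = X'∕Z`, also on a null class (both sides `0`)
  have canc : ∀ (X X' : ι → ℝ) (Zt : ℝ), (∀ τ ∈ T, X τ = 0 → X' τ = 0) →
      ∑ τ ∈ T, X τ / Zt * (X' τ / X τ) = (∑ τ ∈ T, X' τ) / Zt := by
    intro X X' Zt hX
    rw [sum_div]
    refine sum_congr rfl fun τ hτ => ?_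
    by_cases h : X τ = 0
    · rw [h, hX τ hτ h]; simp
    · rw [div_mul_div_comm, mul_comm (X τ) (X' τ), mul_div_mul_right _ _ h]
  have e1 := canc B B' (∑ σ ∈ T, B σ) hB
  have e2 := canc A A' (∑ σ ∈ T, A σ) hA
  have e3 : ∑ τ ∈ T, B τ / (∑ σ ∈ T, B σ) * (B' τ / B τ - A' τ / A τ)
      = ∑ τ ∈ T, B τ / (∑ σ ∈ T, B σ) * (B' τ / B τ) - ∑ τ ∈ T, B τ / (∑ σ ∈ T, B σ) * (A' τ / A τ) := by
    rw [← sum_sub_distrib]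
    exact sum_congr rfl fun τ _ => by ring
  rw [e3, e1, e2]
  ring

/-- **★ THE ONE-KEY KERNEL OF THE TARGET FOR NON-NEGATIVE WEIGHTS** [folklore; p618011 `abs_response_le` with `0 < A, B` weakened to `0 ≤ A, B` + the null rule].
Non-negative class weights with positive totals, derivative carriers obeying the null rule, any centring `m`:
`|Z_B'∕Z_B − Z_A'∕Z_A| ≤ |Σ_T q·(B'∕B − A'∕A)| + 2·√(2(1 − Σ_T √(p·q)))·√(Σ_T ½(p+q)(A'∕A − m)²)` — the coupling lemma (p616874 `abs_mean_sub_mean_le_hellinger`) needs laws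
only. -/
theorem abs_response_le_of_nonneg {A B A' B' : ι → ℝ} (hA0 : ∀ τ ∈ T, 0 ≤ A τ) (hB0 : ∀ τ ∈ T, 0 ≤ B τ)
    (hZA : 0 < ∑ τ ∈ T, A τ) (hZB : 0 < ∑ τ ∈ T, B τ)
    (hA : ∀ τ ∈ T, A τ = 0 → A' τ = 0) (hB : ∀ τ ∈ T, B τ = 0 → B' τ = 0) (m : ℝ) :
    |(∑ τ ∈ T, B' τ) / (∑ τ ∈ T, B τ) - (∑ τ ∈ T, A' τ) / (∑ τ ∈ T, A τ)|
      ≤ |∑ τ ∈ T, B τ / (∑ σ ∈ T, B σ) * (B' τ / B τ - A' τ / A τ)|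
        + 2 * Real.sqrt (2 * (1 - ∑ τ ∈ T, Real.sqrt ((A τ / ∑ σ ∈ T, A σ) * (B τ / ∑ σ ∈ T, B σ))))
          * Real.sqrt (∑ τ ∈ T, (A τ / (∑ σ ∈ T, A σ) + B τ / (∑ σ ∈ T, B σ)) / 2 * (A' τ / A τ - m) ^ 2) := by
  rw [response_split_of_nullRule hA hB]
  have hc := abs_mean_sub_mean_le_hellinger (div_total_nonneg T hA0 hZA) (div_total_nonneg T hB0 hZB)
    (sum_div_total_eq_one T hZA) (sum_div_total_eq_one T hZB) (fun τ => A' τ / A τ) m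
  exact (abs_add_le _ _).trans (add_le_add le_rfl hc)

/-- [bookkeeping] A non-negative family with ONE positive member has a positive total. -/
theorem total_pos_of_twoSided {A : ι → ℝ} (hA0 : ∀ τ ∈ T, 0 ≤ A τ) {σ : ι} (hσ : σ ∈ T) (hσA : 0 < A σ) : 0 < ∑ τ ∈ T, A τ :=
  lt_of_lt_of_le hσA (single_le_sum hA0 hσ)

/-- **★ ONE TWO-SIDED LIVE CLASS MAKES EVERY CLASS-LAW GAP STRICTLY SUB-UNIT** [folklore].  Non-negative weights `A, B` on `T`, a class `σ ∈ T` with `0 < A σ` and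
`0 < B σ`, any `S ⊆ T`: `|Σ_S A ∕ Σ_T A − Σ_S B ∕ Σ_T B| < 1` — if `σ ∈ S` then `q(S) ≥ q_σ > 0` and `p(S) ≤ 1`; if `σ ∉ S` then `p(S) ≤ 1 − p_σ < 1` and `q(S) ≥ 0`
(and symmetrically).  Without such a class the two laws can be mutually singular and the gap `= 1` (dag-n20-w4 p607565: then no `HybridNE7` exists). -/
theorem abs_classLawGap_lt_one_of_twoSided {A B : ι → ℝ} (hA0 : ∀ τ ∈ T, 0 ≤ A τ) (hB0 : ∀ τ ∈ T, 0 ≤ B τ)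
    {σ : ι} (hσ : σ ∈ T) (hσA : 0 < A σ) (hσB : 0 < B σ) {S : Finset ι} (hS : S ⊆ T) :
    |(∑ τ ∈ S, A τ) / (∑ τ ∈ T, A τ) - (∑ τ ∈ S, B τ) / (∑ τ ∈ T, B τ)| < 1 := by
  classical
  have hZA : 0 < ∑ τ ∈ T, A τ := total_pos_of_twoSided hA0 hσ hσA
  have hZB : 0 < ∑ τ ∈ T, B τ := total_pos_of_twoSided hB0 hσ hσB
  have hSA0 : 0 ≤ ∑ τ ∈ S, A τ := sum_nonneg fun τ hτ => hA0 τ (hS hτ)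
  have hSB0 : 0 ≤ ∑ τ ∈ S, B τ := sum_nonneg fun τ hτ => hB0 τ (hS hτ)
  have hSA1 : ∑ τ ∈ S, A τ ≤ ∑ τ ∈ T, A τ := sum_le_sum_of_subset_of_nonneg hS fun τ hτ _ => hA0 τ hτ
  have hSB1 : ∑ τ ∈ S, B τ ≤ ∑ τ ∈ T, B τ := sum_le_sum_of_subset_of_nonneg hS fun τ hτ _ => hB0 τ hτ
  have ha0 : 0 ≤ (∑ τ ∈ S, A τ) / (∑ τ ∈ T, A τ) := div_nonneg hSA0 hZA.le
  have hb0 : 0 ≤ (∑ τ ∈ S, B τ) / (∑ τ ∈ T, B τ) := div_nonneg hSB0 hZB.le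
  have ha1 : (∑ τ ∈ S, A τ) / (∑ τ ∈ T, A τ) ≤ 1 := div_le_one_of_le₀ hSA1 hZA.le
  have hb1 : (∑ τ ∈ S, B τ) / (∑ τ ∈ T, B τ) ≤ 1 := div_le_one_of_le₀ hSB1 hZB.le
  by_cases hσS : σ ∈ S
  · -- `σ ∈ S`: both restricted masses are positive
    have haS : 0 < (∑ τ ∈ S, A τ) / (∑ τ ∈ T, A τ) := div_pos (total_pos_of_twoSided (fun τ hτ => hA0 τ (hS hτ)) hσS hσA) hZA
    have hbS : 0 < (∑ τ ∈ S, B τ) / (∑ τ ∈ T, B τ) := div_pos (total_pos_of_twoSided (fun τ hτ => hB0 τ (hS hτ)) hσS hσB) hZB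
    rw [abs_lt]; constructor <;> linarith
  · -- `σ ∉ S`: both restricted masses miss `σ`'s positive mass
    have hSσ : insert σ S ⊆ T := insert_subset hσ hS
    have haS : ∑ τ ∈ S, A τ + A σ ≤ ∑ τ ∈ T, A τ := by
      have := sum_le_sum_of_subset_of_nonneg hSσ fun τ hτ _ => hA0 τ hτ
      rwa [sum_insert hσS, add_comm] at this
    have hbS : ∑ τ ∈ S, B τ + B σ ≤ ∑ τ ∈ T, B τ := by
      have := sum_le_sum_of_subset_of_nonneg hSσ fun τ hτ _ => hB0 τ hτ
      rwa [sum_insert hσS, add_comm] at this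
    have ha' : (∑ τ ∈ S, A τ) / (∑ τ ∈ T, A τ) < 1 := by
      rw [div_lt_one hZA]; linarith
    have hb' : (∑ τ ∈ S, B τ) / (∑ τ ∈ T, B τ) < 1 := by
      rw [div_lt_one hZB]; linarith
    rw [abs_lt]; constructor <;> linarith

/-- **(R‑c) FROM A BOUNDED CURRENT, NON-NEGATIVE WEIGHTS** [folklore; p626582 `mixtureCurrentMoment_le_sq_of_boundedCurrent` with `0 ≤ A, B`].  `|A' τ| ≤ M·A τ` on `T`
(so a null class has null current) ⇒ `Σ_T ½(p+q)·(A'∕A − 0)² ≤ M²`. -/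
theorem mixtureCurrentMoment_le_sq_of_boundedCurrent_of_nonneg {A B A' : ι → ℝ} {M : ℝ} (hM : 0 ≤ M)
    (hA0 : ∀ τ ∈ T, 0 ≤ A τ) (hB0 : ∀ τ ∈ T, 0 ≤ B τ)
    (hZA : 0 < ∑ τ ∈ T, A τ) (hZB : 0 < ∑ τ ∈ T, B τ) (hcur : ∀ τ ∈ T, |A' τ| ≤ M * A τ) :
    ∑ τ ∈ T, (A τ / (∑ σ ∈ T, A σ) + B τ / (∑ σ ∈ T, B σ)) / 2 * (A' τ / A τ - 0) ^ 2 ≤ M ^ 2 := by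
  have hsq : ∀ τ ∈ T, (A' τ / A τ - 0) ^ 2 ≤ M ^ 2 := by
    intro τ hτ
    rw [sub_zero, ← sq_abs]
    refine pow_le_pow_left₀ (abs_nonneg _) ?_ 2
    rcases (hA0 τ hτ).eq_or_lt with h | h
    · rw [← h]; simpa using hM
    · rw [abs_div, abs_of_pos h, div_le_iff₀ h]
      exact hcur τ hτ
  have hw : ∀ τ ∈ T, 0 ≤ (A τ / (∑ σ ∈ T, A σ) + B τ / (∑ σ ∈ T, B σ)) / 2 := fun τ hτ =>
    div_nonneg (add_nonneg (div_nonneg (hA0 τ hτ) hZA.le) (div_nonneg (hB0 τ hτ) hZB.le)) (by norm_num)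
  have hmass : ∑ τ ∈ T, (A τ / (∑ σ ∈ T, A σ) + B τ / (∑ σ ∈ T, B σ)) / 2 = 1 := by
    rw [← sum_div, sum_add_distrib, ← sum_div, ← sum_div, div_self hZA.ne', div_self hZB.ne']
    norm_num
  calc ∑ τ ∈ T, (A τ / (∑ σ ∈ T, A σ) + B τ / (∑ σ ∈ T, B σ)) / 2 * (A' τ / A τ - 0) ^ 2
      ≤ ∑ τ ∈ T, (A τ / (∑ σ ∈ T, A σ) + B τ / (∑ σ ∈ T, B σ)) / 2 * M ^ 2 :=
        sum_le_sum fun τ hτ => mul_le_mul_of_nonneg_left (hsq τ hτ) (hw τ hτ)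
    _ = M ^ 2 := by rw [← sum_mul, hmass, one_mul]

/-- **★ THE ONE-SIDED MASS IS PAID BY THE AFFINITY DEFECT** [folklore; Cauchy–Schwarz].  Two laws `p, q ≥ 0` of total mass one on `T`; the classes of `T` NULL under
`q` carry `p`-mass at most `1 − 𝒜²` (`≤ 2(1 − 𝒜)`), `𝒜 = Σ_T √(p·q)`: the affinity lives on the `q`-live classes, where Cauchy–Schwarz bounds `𝒜²` by `p(live)·q(live) ≤
1 − p(null)`.  So the (H) letter `1 − 𝒜_K ≤ η_K` already bounds the one-sided mass that null classes push into the shells — allowing them costs the road nothing. -/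
theorem classLaw_nullSet_le_one_sub_affinity_sq [DecidableEq ι] {p q : ι → ℝ} (hp : ∀ τ ∈ T, 0 ≤ p τ) (hq : ∀ τ ∈ T, 0 ≤ q τ)
    (hp1 : ∑ τ ∈ T, p τ = 1) (hq1 : ∑ τ ∈ T, q τ = 1) :
    ∑ τ ∈ T.filter (fun τ => q τ = 0), p τ ≤ 1 - (∑ τ ∈ T, Real.sqrt (p τ * q τ)) ^ 2 := by
  set N := T.filter (fun τ => q τ = 0) with hN
  have hNT : N ⊆ T := filter_subset _ _
  -- the affinity lives off `N`
  have haff : ∑ τ ∈ T, Real.sqrt (p τ * q τ) = ∑ τ ∈ T \ N, Real.sqrt (p τ) * Real.sqrt (q τ) := by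
    rw [← sum_sdiff hNT]
    have h0 : ∑ τ ∈ N, Real.sqrt (p τ * q τ) = 0 := sum_eq_zero fun τ hτ => by
      rw [(mem_filter.1 hτ).2, mul_zero, Real.sqrt_zero]
    rw [h0, add_zero]
    exact sum_congr rfl fun τ hτ => Real.sqrt_mul (hp τ ((mem_sdiff.1 hτ).1)) _
  -- Cauchy–Schwarz on `T ∖ N`
  have hCS := sum_mul_sq_le_sq_mul_sq (T \ N) (fun τ => Real.sqrt (p τ)) (fun τ => Real.sqrt (q τ))
  have hpT : ∑ τ ∈ T \ N, Real.sqrt (p τ) ^ 2 = ∑ τ ∈ T \ N, p τ := sum_congr rfl fun τ hτ => Real.sq_sqrt (hp τ (mem_sdiff.1 hτ).1)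
  have hqT : ∑ τ ∈ T \ N, Real.sqrt (q τ) ^ 2 = ∑ τ ∈ T \ N, q τ := sum_congr rfl fun τ hτ => Real.sq_sqrt (hq τ (mem_sdiff.1 hτ).1)
  rw [hpT, hqT] at hCS
  have hpsplit : ∑ τ ∈ T \ N, p τ = 1 - ∑ τ ∈ N, p τ := by rw [← hp1, ← sum_sdiff hNT]; ring
  have hqle : ∑ τ ∈ T \ N, q τ ≤ 1 := hq1 ▸ sum_le_sum_of_subset_of_nonneg sdiff_subset fun τ hτ _ => hq τ hτ
  have hq0 : 0 ≤ ∑ τ ∈ T \ N, q τ := sum_nonneg fun τ hτ => hq τ (mem_sdiff.1 hτ).1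
  have hp0 : 0 ≤ ∑ τ ∈ T \ N, p τ := sum_nonneg fun τ hτ => hp τ (mem_sdiff.1 hτ).1
  rw [haff]
  nlinarith [mul_le_mul_of_nonneg_left hqle hp0]

end OneKey

/-! ## §2 Along `K`: the endpoint road for non-negative class weights, head = a two-sided live class at every key and source [folklore] -/

section Road
variable {l₀ vol : ℝ} {T : ℕ → Finset ι} {A B : ℕ → ℝ → ι → ℝ}

/-- **THE NULL RULE FROM NON-NEGATIVITY** [folklore; §1's Fermat rule along `K`].  Class weights `≥ 0` at EVERY source and differentiable at the window points with
carriers `A'` ⇒ on the window a null class has null current: `A K s τ = 0 → A' K s τ = 0`. -/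
theorem nullRule_of_nonneg (hA0 : ∀ (K : ℕ) (t : ℝ), ∀ τ ∈ T K, 0 ≤ A K t τ) {A' : ℕ → ℝ → ι → ℝ}
    (hdA : ∀ (K : ℕ) (s : ℝ), |s| ≤ l₀ → ∀ τ ∈ T K, HasDerivAt (fun u => A K u τ) (A' K s τ) s)
    (K : ℕ) {s : ℝ} (hs : |s| ≤ l₀) : ∀ τ ∈ T K, A K s τ = 0 → A' K s τ = 0 :=
  fun τ hτ h0 => deriv_eq_zero_of_nonneg_of_eq_zero (fun u => hA0 K u τ hτ) h0 (hdA K s hs τ hτ)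

/-- [bookkeeping] A two-sided live class at `(K, t)` gives both totals positive there. -/
theorem totals_pos_of_twoSided (hA0 : ∀ (K : ℕ) (t : ℝ), ∀ τ ∈ T K, 0 ≤ A K t τ) (hB0 : ∀ (K : ℕ) (t : ℝ), ∀ τ ∈ T K, 0 ≤ B K t τ)
    (hlive : ∀ (K : ℕ) (t : ℝ), |t| ≤ l₀ → ∃ σ ∈ T K, 0 < A K t σ ∧ 0 < B K t σ) (K : ℕ) {t : ℝ} (ht : |t| ≤ l₀) :
    0 < ∑ τ ∈ T K, A K t τ ∧ 0 < ∑ τ ∈ T K, B K t τ := by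
  obtain ⟨σ, hσ, hσA, hσB⟩ := hlive K t ht
  exact ⟨total_pos_of_twoSided (hA0 K t) hσ hσA, total_pos_of_twoSided (hB0 K t) hσ hσB⟩

/-- **(H) ⇒ THE CLASS-LAW TV LETTER, NON-NEGATIVE WEIGHTS** [folklore; p619159 `classLawTV_of_affinityDefect` for `0 ≤ A, B`].  Positive totals on the window and the
affinity-defect letter `1 − Σ_T √(p_{K,t} q_{K,t}) ≤ η_K` ⇒ `|p_{K,t}(S) − q_{K,t}(S)| ≤ √(2η_K)` for every `S ⊆ T K` (Le Cam through dag-n19-w2's p612301). -/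
theorem classLawTV_of_affinityDefect_of_nonneg [DecidableEq ι]
    (hA0 : ∀ (K : ℕ) (t : ℝ), ∀ τ ∈ T K, 0 ≤ A K t τ) (hB0 : ∀ (K : ℕ) (t : ℝ), ∀ τ ∈ T K, 0 ≤ B K t τ)
    (hZA : ∀ (K : ℕ) (t : ℝ), |t| ≤ l₀ → 0 < ∑ τ ∈ T K, A K t τ) (hZB : ∀ (K : ℕ) (t : ℝ), |t| ≤ l₀ → 0 < ∑ τ ∈ T K, B K t τ)
    {η : ℕ → ℝ}
    (hH : ∀ (K : ℕ) (t : ℝ), |t| ≤ l₀ →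
      1 - ∑ τ ∈ T K, Real.sqrt ((A K t τ / ∑ σ ∈ T K, A K t σ) * (B K t τ / ∑ σ ∈ T K, B K t σ)) ≤ η K) :
    ∀ (K : ℕ) (t : ℝ), |t| ≤ l₀ → ∀ S ⊆ T K,
      |(∑ τ ∈ S, A K t τ) / (∑ τ ∈ T K, A K t τ) - (∑ τ ∈ S, B K t τ) / (∑ τ ∈ T K, B K t τ)| ≤ Real.sqrt (2 * η K) := by
  intro K t ht S hS
  refine ((abs_classLawGap_le_sqrt_one_sub_affinity_sq (T K) (hA0 K t) (hB0 K t) (hZA K t ht) (hZB K t ht) hS).trans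
    (sqrt_one_sub_sq_le _)).trans ?_
  exact Real.sqrt_le_sqrt (by linarith [hH K t ht])

/-- [bookkeeping] (H) read at `t = 0` makes `η_K ≥ 0`, non-negative weights (the affinity of two laws is at most one). -/
theorem eta_nonneg_of_affinityDefect_of_nonneg (hl₀ : 0 ≤ l₀)
    (hA0 : ∀ (K : ℕ) (t : ℝ), ∀ τ ∈ T K, 0 ≤ A K t τ) (hB0 : ∀ (K : ℕ) (t : ℝ), ∀ τ ∈ T K, 0 ≤ B K t τ)
    (hZA : ∀ (K : ℕ) (t : ℝ), |t| ≤ l₀ → 0 < ∑ τ ∈ T K, A K t τ) (hZB : ∀ (K : ℕ) (t : ℝ), |t| ≤ l₀ → 0 < ∑ τ ∈ T K, B K t τ)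
    {η : ℕ → ℝ}
    (hH : ∀ (K : ℕ) (t : ℝ), |t| ≤ l₀ →
      1 - ∑ τ ∈ T K, Real.sqrt ((A K t τ / ∑ σ ∈ T K, A K t σ) * (B K t τ / ∑ σ ∈ T K, B K t σ)) ≤ η K) (K : ℕ) :
    0 ≤ η K := by
  have h0 : |(0:ℝ)| ≤ l₀ := by simpa using hl₀
  have h1 := affinity_le_one (T K) (div_total_nonneg (T K) (hA0 K 0) (hZA K 0 h0))
    (div_total_nonneg (T K) (hB0 K 0) (hZB K 0 h0)) (sum_div_total_eq_one (T K) (hZA K 0 h0)) (sum_div_total_eq_one (T K) (hZB K 0 h0))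
  linarith [hH K 0 h0]

/-- **★★ (H) + (R′) + (R‑c) ⇒ NODE U5's DECL TARGET, NON-NEGATIVE WEIGHTS** [folklore; p619159 `target_of_endpointResponse` with `0 ≤ A, B`].  Class weights `≥ 0` at
every source, positive totals on the window `|s| ≤ l₀` (`0 ≤ l₀`, `0 < vol`), DIFFERENTIABLE there with carriers `A', B'`, the E1∕E2 dictionary for `Z`; (H) with
`Σ √η_K < ∞`; (R′) `|Σ_T q_{K,s}·(B'∕B − A'∕A)| ≤ R₁ K`, `Σ R₁ < ∞`; (R‑c) `Σ_T ½(p+q)(A'∕A − m_{K,s})² ≤ χ` ⇒ `Target vol l₀ (K ↦ l₀·(R₁ K + 2√(2η_K)√χ)∕vol) Z`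
with constants `c_K := log Z_{K+1}(0) − log Z_K(0)`.  Null classes enter (R′)∕(R‑c) with current `0` (Lean's `x ∕ 0`), consistently with §1's Fermat rule. -/
theorem target_of_endpointResponse_of_nonneg (hl₀ : 0 ≤ l₀) (hvol : 0 < vol)
    (hA0 : ∀ (K : ℕ) (t : ℝ), ∀ τ ∈ T K, 0 ≤ A K t τ) (hB0 : ∀ (K : ℕ) (t : ℝ), ∀ τ ∈ T K, 0 ≤ B K t τ)
    (hZA : ∀ (K : ℕ) (t : ℝ), |t| ≤ l₀ → 0 < ∑ τ ∈ T K, A K t τ) (hZB : ∀ (K : ℕ) (t : ℝ), |t| ≤ l₀ → 0 < ∑ τ ∈ T K, B K t τ)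
    {Z : ℕ → ℝ → ℝ} (hZA' : ∀ (K : ℕ) (t : ℝ), |t| ≤ l₀ → Z K t = ∑ τ ∈ T K, A K t τ)
    (hZB' : ∀ (K : ℕ) (t : ℝ), |t| ≤ l₀ → Z (K + 1) t = ∑ τ ∈ T K, B K t τ)
    {A' B' : ℕ → ℝ → ι → ℝ}
    (hdA : ∀ (K : ℕ) (s : ℝ), |s| ≤ l₀ → ∀ τ ∈ T K, HasDerivAt (fun u => A K u τ) (A' K s τ) s)
    (hdB : ∀ (K : ℕ) (s : ℝ), |s| ≤ l₀ → ∀ τ ∈ T K, HasDerivAt (fun u => B K u τ) (B' K s τ) s)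
    {η R₁ : ℕ → ℝ} {χ : ℝ} {m : ℕ → ℝ → ℝ}
    (hH : ∀ (K : ℕ) (t : ℝ), |t| ≤ l₀ →
      1 - ∑ τ ∈ T K, Real.sqrt ((A K t τ / ∑ σ ∈ T K, A K t σ) * (B K t τ / ∑ σ ∈ T K, B K t σ)) ≤ η K)
    (hR : ∀ (K : ℕ) (s : ℝ), |s| ≤ l₀ →
      |∑ τ ∈ T K, B K s τ / (∑ σ ∈ T K, B K s σ) * (B' K s τ / B K s τ - A' K s τ / A K s τ)| ≤ R₁ K)
    (hχ : ∀ (K : ℕ) (s : ℝ), |s| ≤ l₀ →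
      ∑ τ ∈ T K, (A K s τ / (∑ σ ∈ T K, A K s σ) + B K s τ / (∑ σ ∈ T K, B K s σ)) / 2 * (A' K s τ / A K s τ - m K s) ^ 2 ≤ χ)
    (hηs : Summable fun K => Real.sqrt (η K)) (hRs : Summable R₁) :
    Target vol l₀ (fun K => l₀ * (R₁ K + 2 * Real.sqrt (2 * η K) * Real.sqrt χ) / vol) Z := by
  have h0 : |(0:ℝ)| ≤ l₀ := by simpa using hl₀
  refine ⟨fun K => ⟨Real.log (Z (K + 1) 0) - Real.log (Z K 0), fun t ht => ?_⟩, ?_⟩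
  · -- the target function at level `K` and its derivative bound on the window
    have hder : ∀ s, |s| ≤ l₀ → HasDerivAt (fun u => Real.log (∑ τ ∈ T K, B K u τ) - Real.log (∑ τ ∈ T K, A K u τ))
        ((∑ τ ∈ T K, B' K s τ) / (∑ τ ∈ T K, B K s τ) - (∑ τ ∈ T K, A' K s τ) / (∑ τ ∈ T K, A K s τ)) s :=
      fun s hs => hasDerivAt_log_total_sub_log_total (hdA K s hs) (hdB K s hs) (hZA K s hs).ne' (hZB K s hs).ne'
    have hbd : ∀ s, |s| ≤ l₀ →
        |(∑ τ ∈ T K, B' K s τ) / (∑ τ ∈ T K, B K s τ) - (∑ τ ∈ T K, A' K s τ) / (∑ τ ∈ T K, A K s τ)|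
          ≤ R₁ K + 2 * Real.sqrt (2 * η K) * Real.sqrt χ := by
      intro s hs
      have h1 := abs_response_le_of_nonneg (hA0 K s) (hB0 K s) (hZA K s hs) (hZB K s hs)
        (nullRule_of_nonneg hA0 hdA K hs) (nullRule_of_nonneg hB0 hdB K hs) (A' := A' K s) (B' := B' K s) (m K s)
      have h2 : Real.sqrt (2 * (1 - ∑ τ ∈ T K, Real.sqrt ((A K s τ / ∑ σ ∈ T K, A K s σ) * (B K s τ / ∑ σ ∈ T K, B K s σ))))
          ≤ Real.sqrt (2 * η K) := Real.sqrt_le_sqrt (by linarith [hH K s hs])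
      have h3 : Real.sqrt (∑ τ ∈ T K, (A K s τ / (∑ σ ∈ T K, A K s σ) + B K s τ / (∑ σ ∈ T K, B K s σ)) / 2
            * (A' K s τ / A K s τ - m K s) ^ 2) ≤ Real.sqrt χ := Real.sqrt_le_sqrt (hχ K s hs)
      have h4 := mul_le_mul h2 h3 (Real.sqrt_nonneg _) (Real.sqrt_nonneg _)
      linarith [hR K s hs]
    have key := matchingModConstants_of_derivative_bound hl₀ hder hbd t ht
    rw [hZA' K t ht, hZB' K t ht, hZA' K 0 h0, hZB' K 0 h0]
    have e : vol * (l₀ * (R₁ K + 2 * Real.sqrt (2 * η K) * Real.sqrt χ) / vol)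
        = (R₁ K + 2 * Real.sqrt (2 * η K) * Real.sqrt χ) * l₀ := by
      field_simp
    rw [e]
    simpa [sub_sub] using key
  · -- summability of the radius
    have hs2 : Summable fun K => Real.sqrt (2 * η K) := by
      have : (fun K => Real.sqrt (2 * η K)) = fun K => Real.sqrt 2 * Real.sqrt (η K) := by
        funext K; exact Real.sqrt_mul (by norm_num) _
      rw [this]; exact hηs.mul_left _
    have h3 : Summable fun K => R₁ K + 2 * Real.sqrt (2 * η K) * Real.sqrt χ := by
      have := (hs2.mul_left 2).mul_right (Real.sqrt χ)
      exact hRs.add (by simpa [mul_assoc] using this)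
    simpa [mul_div_assoc] using ((h3.mul_left l₀).div_const vol)

/-- **★★ A SUMMABLE PER-SET TV BUDGET IS STRICTLY SUB-UNIT AT EVERY KEY, NON-NEGATIVE WEIGHTS** [folklore: extreme value theorem; p623765
`exists_classLawTV_budget_lt_one` with positivity replaced by its necessary residue].  Class weights `≥ 0`, CONTINUOUS in the source on the compact window
`|t| ≤ l₀` (`0 ≤ l₀`), and at every `(K, t)` there SOME class live under BOTH runs; a per-set TV letter with a summable budget `ρ ≥ 0` ⇒ a budget `ρ'` with
`0 ≤ ρ' K ≤ ρ K`, `ρ' K < 1` for EVERY `K`, `Summable ρ'`, same letter.  (Each gap is continuous on the window — totals never vanish there — and attains a maximum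
`< 1` by `abs_classLawGap_lt_one_of_twoSided`; finitely many `S ⊆ T K`.) -/
theorem exists_classLawTV_budget_lt_one_of_nonneg [DecidableEq ι] (hl₀ : 0 ≤ l₀)
    (hA0 : ∀ (K : ℕ) (t : ℝ), ∀ τ ∈ T K, 0 ≤ A K t τ) (hB0 : ∀ (K : ℕ) (t : ℝ), ∀ τ ∈ T K, 0 ≤ B K t τ)
    (hlive : ∀ (K : ℕ) (t : ℝ), |t| ≤ l₀ → ∃ σ ∈ T K, 0 < A K t σ ∧ 0 < B K t σ)
    (hcA : ∀ (K : ℕ), ∀ τ ∈ T K, ContinuousOn (fun t => A K t τ) (Set.Icc (-l₀) l₀))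
    (hcB : ∀ (K : ℕ), ∀ τ ∈ T K, ContinuousOn (fun t => B K t τ) (Set.Icc (-l₀) l₀))
    {ρ : ℕ → ℝ} (hρ0 : ∀ K, 0 ≤ ρ K) (hρs : Summable ρ)
    (hρ : ∀ (K : ℕ) (t : ℝ), |t| ≤ l₀ → ∀ S ⊆ T K,
      |(∑ τ ∈ S, A K t τ) / (∑ τ ∈ T K, A K t τ) - (∑ τ ∈ S, B K t τ) / (∑ τ ∈ T K, B K t τ)| ≤ ρ K) :
    ∃ ρ' : ℕ → ℝ, (∀ K, 0 ≤ ρ' K) ∧ (∀ K, ρ' K ≤ ρ K) ∧ (∀ K, ρ' K < 1) ∧ Summable ρ' ∧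
      ∀ (K : ℕ) (t : ℝ), |t| ≤ l₀ → ∀ S ⊆ T K,
        |(∑ τ ∈ S, A K t τ) / (∑ τ ∈ T K, A K t τ) - (∑ τ ∈ S, B K t τ) / (∑ τ ∈ T K, B K t τ)| ≤ ρ' K := by
  have hIcc : ∀ {t : ℝ}, t ∈ Set.Icc (-l₀) l₀ ↔ |t| ≤ l₀ := fun {t} => by rw [Set.mem_Icc, abs_le]
  have hcpt : IsCompact (Set.Icc (-l₀) l₀) := isCompact_Icc
  have hne : (Set.Icc (-l₀) l₀).Nonempty := ⟨0, by rw [Set.mem_Icc]; constructor <;> linarith⟩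
  have hZ := totals_pos_of_twoSided hA0 hB0 hlive
  -- per key: a uniform strict bound over the window and over all `S ⊆ T K`
  have key : ∀ K : ℕ, ∃ M : ℝ, M < 1 ∧ ∀ t : ℝ, |t| ≤ l₀ → ∀ S ⊆ T K,
      |(∑ τ ∈ S, A K t τ) / (∑ τ ∈ T K, A K t τ) - (∑ τ ∈ S, B K t τ) / (∑ τ ∈ T K, B K t τ)| ≤ M := by
    intro K
    have perS : ∀ S ∈ (T K).powerset, ∃ m : ℝ, m < 1 ∧ ∀ t : ℝ, |t| ≤ l₀ →
        |(∑ τ ∈ S, A K t τ) / (∑ τ ∈ T K, A K t τ) - (∑ τ ∈ S, B K t τ) / (∑ τ ∈ T K, B K t τ)| ≤ m := by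
      intro S hS
      rw [mem_powerset] at hS
      set g : ℝ → ℝ := fun t =>
        |(∑ τ ∈ S, A K t τ) / (∑ τ ∈ T K, A K t τ) - (∑ τ ∈ S, B K t τ) / (∑ τ ∈ T K, B K t τ)| with hg
      have hsumA : ∀ U ⊆ T K, ContinuousOn (fun t => ∑ τ ∈ U, A K t τ) (Set.Icc (-l₀) l₀) := fun U hU =>
        continuousOn_finsetSum U fun τ hτ => hcA K τ (hU hτ)
      have hsumB : ∀ U ⊆ T K, ContinuousOn (fun t => ∑ τ ∈ U, B K t τ) (Set.Icc (-l₀) l₀) := fun U hU =>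
        continuousOn_finsetSum U fun τ hτ => hcB K τ (hU hτ)
      have hgc : ContinuousOn g (Set.Icc (-l₀) l₀) :=
        ((ContinuousOn.div (hsumA S hS) (hsumA (T K) subset_rfl) fun t ht => (hZ K (hIcc.1 ht)).1.ne').sub
          (ContinuousOn.div (hsumB S hS) (hsumB (T K) subset_rfl) fun t ht => (hZ K (hIcc.1 ht)).2.ne')).abs
      obtain ⟨t₀, ht₀, hmax⟩ := hcpt.exists_isMaxOn hne hgc
      obtain ⟨σ, hσ, hσA, hσB⟩ := hlive K t₀ (hIcc.1 ht₀)
      exact ⟨g t₀, abs_classLawGap_lt_one_of_twoSided (hA0 K t₀) (hB0 K t₀) hσ hσA hσB hS, fun t ht => hmax (hIcc.2 ht)⟩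
    choose! m hm1 hm2 using perS
    have hne' : (T K).powerset.Nonempty := ⟨∅, empty_mem_powerset _⟩
    refine ⟨(T K).powerset.sup' hne' m, (Finset.sup'_lt_iff hne').2 fun S hS => hm1 S hS, fun t ht S hS => ?_⟩
    have hSp : S ∈ (T K).powerset := mem_powerset.2 hS
    exact (hm2 S hSp t ht).trans (Finset.le_sup' m hSp)
  choose M hM1 hM2 using key
  refine ⟨fun K => min (ρ K) (max (M K) 0), fun K => le_min (hρ0 K) (le_max_right _ _), fun K => min_le_left _ _,
    fun K => (min_le_right _ _).trans_lt (max_lt (hM1 K) one_pos), ?_, fun K t ht S hS => ?_⟩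
  · exact Summable.of_nonneg_of_le (fun K => le_min (hρ0 K) (le_max_right _ _)) (fun K => min_le_left _ _) hρs
  · exact le_min (hρ K t ht S hS) ((hM2 K t ht S hS).trans (le_max_left _ _))

end Road

end Summit.QuantumFields.YangMills.BalabanUVNodes.N20HellingerRoadNullClassesKernel

end
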